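import Literature.Geometry.Riemannian.RicciFlowScalarCurvature
import Literature.Geometry.Lorentzian.CurvatureRegularity
import HarnessLib

/-!
# The scalar curvature of a Ricci flow is jointly continuous in space and time
(topic `Geometry/Riemannian`)

Regularity glue for the Ricci-flow layer (`RicciFlow.lean`, `RicciFlowMaximal.lean`,
`CanonicalNeighbourhoods.lean`). Along a Ricci flow `(g, cov)` on a time set `S`
(`IsRicciFlow`: the family `(x, t) ↦ g_t(x)` is `C^∞` on `M × S`, each `cov t` is a Levi-Civita
connection of `g t`, and `∂/∂t g_t(x)(X, Y) = -2 Ric_{g_t}(x)(X, Y)` within `S`), the scalar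
curvature `R(x, t) = tr_{g_t} Ric(cov t)_x` (`scalarCurvatureWith`) is a continuous function of
`(x, t)` on `M × S`, and hence bounded on `M × [0, t₁]` for every compact `M` and every
`[0, t₁] ⊆ S` — the elementary fact used silently whenever the sources pass from "smooth solution
on `[0, T)`" to "bounded curvature before `T`" (Topping 2006, §7.3: "picking `(p_i, t_i)` to
maximise `|Rm|` over `M × [0, T - 1/i]`"; Chen–Zhu 2006, §5, p. 26).

## The proof (no curvature regularity theory is needed)

The Ricci flow equation identifies the Ricci tensor with a time derivative of the metric:
`Ric_{g_t}(x)(X, Y) = -½ ∂/∂t g_t(x)(X, Y)`. Near `x₀` let `sᵢ` be the smooth local frame of `TM`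
induced by the trivialization at `x₀` (Mathlib's `Trivialization.localFrame`). Then
* `(x, t) ↦ g_t(x)(sᵢ x, sⱼ x)` is `C^∞` on `U × S` (`U` the chart domain of `x₀`), by Mathlib's
  `ContMDiffOn.clm_bundle_apply₂` over the base map `(x, t) ↦ x` (`contMDiffOn_val_localFrame`);
* read in the chart of `x₀` it is a `C^∞` function on `φ(U) × S ⊆ E × ℝ`, whose derivative within
  that set is continuous (`ContDiffOn.continuousOn_fderivWithin`); its value on the vector
  `(0, 1)` is the time derivative, i.e. `-2 Ric_{g_t}(x)(sᵢ x, sⱼ x)` by the flow equation and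
  uniqueness of one-sided derivatives on `S` — so the frame components of `Ric` are continuous on
  `U × S` (`continuousOn_ricci_localFrame`);
* `R = ∑ᵢⱼ (G⁻¹)ⱼᵢ Ric(sᵢ, sⱼ)` with `G` the Gram matrix of the frame (`trace_eq_sum_gram_inv`,
  `CurvatureRegularity.lean`), and `G⁻¹ = (det G)⁻¹ adj G` has continuous entries.

## Main statements

* `IsRicciFlow.continuousOn_scalarCurvatureWith_prod` — `R` is JOINTLY continuous on `M × S`
  (for time sets with unique one-sided derivatives, `UniqueDiffOn ℝ S`: all intervals `[0, ε]`,
  `[0, T)`, `[0, ∞)` of the layer). The sibling `IsRicciFlow.continuousOn_scalarCurvatureWith` of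
  `RicciFlowScalarCurvatureHolds.lean` is continuity in `t` for a fixed point `x`; joint
  continuity needs the local frames and the chart-read derivative below.
* `IsRicciFlow.exists_scalarCurvatureWith_le` — on a compact manifold, `R ≤ K` on `M × [0, t₁]`
  whenever `[0, t₁] ⊆ S`.

## References

* P. Topping, *Lectures on the Ricci flow*, LMS Lecture Note Series 325 (2006), §1.2.3 (smooth
  families of metrics), §7.3. [Topping2006]
* B.-L. Chen, X.-P. Zhu, J. Differential Geom. 74 (2006), §5, p. 26 (arXiv:math/0504478).
  [ChenZhu2006]
* B. O'Neill, *Semi-Riemannian geometry* (1983), Ch. 3, Def. 3.53 and pp. 60–61. [ONeill1983]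
-/

noncomputable section

open Bundle Set Function Matrix
open scoped Manifold ContDiff Topology BigOperators

namespace Literature.Geometry.Riemannian

open Lorentzian Lorentzian.PseudoRiemannianMetric

variable {E : Type*} [NormedAddCommGroup E] [NormedSpace ℝ E] [FiniteDimensional ℝ E]
  [CompleteSpace E] {H : Type*} [TopologicalSpace H] {I : ModelWithCorners ℝ E H}
  {M : Type*} [TopologicalSpace M] [ChartedSpace H M] [IsManifold I ∞ M]
  {g : ℝ → PseudoRiemannianMetric I ∞ E (TangentSpace I : M → Type _)}
  {cov : ℝ → CovariantDerivative I E (TangentSpace I : M → Type _)} {S : Set ℝ}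

/-! ### Frame components of the metric along a smooth family -/

omit [FiniteDimensional ℝ E] [CompleteSpace E] in
/-- **The frame components `(x, t) ↦ g_t(x)(sᵢ x, sⱼ x)` of a jointly smooth family of metrics are
jointly smooth** on `U × S`, `U` the base set of a trivialization `e` of the tangent bundle and
`sᵢ = e.localFrame` its smooth local frame (Mathlib's `ContMDiffOn.clm_bundle_apply₂` over the
base map `(x, t) ↦ x`; Topping 2006, §1.2.3: a smooth family of metrics has smooth coefficients).
[cite: Topping2006, §1.2.3] -/
theorem IsContMDiffFamilyOn.contMDiffOn_val_localFrame (hg : IsContMDiffFamilyOn ∞ g S)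
    (e : Trivialization E (TotalSpace.proj : TangentBundle I M → M)) [MemTrivializationAtlas e]
    {ι : Type*} (bE : Module.Basis ι ℝ E) (i j : ι) :
    ContMDiffOn (I.prod 𝓘(ℝ, ℝ)) 𝓘(ℝ, ℝ) ∞
      (fun p : M × ℝ ↦ (g p.2).val p.1 (e.localFrame bE i p.1) (e.localFrame bE j p.1))
      (e.baseSet ×ˢ S) := by
  have hψ : ContMDiffOn (I.prod 𝓘(ℝ, ℝ)) (I.prod 𝓘(ℝ, E →L[ℝ] E →L[ℝ] ℝ)) ∞
      (fun p : M × ℝ ↦ TotalSpace.mk' (E →L[ℝ] E →L[ℝ] ℝ) (E := fun b : M ↦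
        TangentSpace I b →L[ℝ] TangentSpace I b →L[ℝ] ℝ) p.1 ((g p.2).val p.1)) (e.baseSet ×ˢ S) :=
    ContMDiffOn.mono hg (prod_mono (subset_univ _) le_rfl)
  have hs : ∀ k, ContMDiffOn (I.prod 𝓘(ℝ, ℝ)) (I.prod 𝓘(ℝ, E)) ∞
      (fun p : M × ℝ ↦ TotalSpace.mk' E (E := (TangentSpace I : M → Type _)) p.1
        (e.localFrame bE k p.1)) (e.baseSet ×ˢ S) := fun k ↦
    (e.contMDiffOn_localFrame_baseSet (I := I) ∞ bE k).comp contMDiffOn_fst fun p hp ↦ hp.1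
  have happ : ContMDiffOn (I.prod 𝓘(ℝ, ℝ)) (I.prod 𝓘(ℝ, ℝ)) ∞
      (fun p : M × ℝ ↦ TotalSpace.mk' ℝ (E := Bundle.Trivial M ℝ) p.1
        ((g p.2).val p.1 (e.localFrame bE i p.1) (e.localFrame bE j p.1))) (e.baseSet ×ˢ S) := by
    apply ContMDiffOn.clm_bundle_apply₂ (F₁ := E) (F₂ := E)
    · exact hψ
    · exact hs i
    · exact hs j
  intro p hp
  have := happ p hp
  rw [contMDiffWithinAt_totalSpace] at this
  exact this.2

/-! ### Frame components of the Ricci tensor along a Ricci flow -/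

/-- **The frame components of the Ricci tensor of a Ricci flow are jointly continuous**: for a
Ricci flow `(g, cov)` on a time set `S` with unique one-sided derivatives and the local frame
`sᵢ` of the trivialization at `x₀`, `(x, t) ↦ Ric_{g_t}(x)(sᵢ x, sⱼ x)` is continuous on `U × S`,
`U` the chart domain of `x₀`. By the flow equation `Ric(sᵢ, sⱼ) = -½ ∂/∂t g_t(sᵢ, sⱼ)`
(Hamilton 1982, (1.1) of Chen–Zhu 2006), and the time derivative of the `C^∞` function
`(x, t) ↦ g_t(x)(sᵢ x, sⱼ x)` (read in the chart of `x₀`) is continuous. [cite: ChenZhu2006, §1, (1.1)] -/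
theorem IsRicciFlow.continuousOn_ricci_localFrame [I.Boundaryless] (h : IsRicciFlow g cov S)
    (hS : UniqueDiffOn ℝ S) (x₀ : M) {ι : Type*} (bE : Module.Basis ι ℝ E) (i j : ι) :
    ContinuousOn (fun p : M × ℝ ↦ (cov p.2).ricci p.1
        ((trivializationAt E (TangentSpace I : M → Type _) x₀).localFrame bE i p.1)
        ((trivializationAt E (TangentSpace I : M → Type _) x₀).localFrame bE j p.1))
      ((chartAt H x₀).source ×ˢ S) := by
  set e := trivializationAt E (TangentSpace I : M → Type _) x₀ with he
  set s : ι → Π x : M, TangentSpace I x := e.localFrame bE with hsdef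
  set ec := extChartAt I x₀ with hec
  -- the frame components, smooth on `U × S`
  set f : M × ℝ → ℝ := fun p ↦ (g p.2).val p.1 (s i p.1) (s j p.1) with hfdef
  have hU : ec.source = e.baseSet := by rw [hec, extChartAt_source]; rfl
  have hf : ContMDiffOn (I.prod 𝓘(ℝ, ℝ)) 𝓘(ℝ, ℝ) ∞ f (ec.source ×ˢ S) := by
    rw [hU]
    exact h.smooth.contMDiffOn_val_localFrame e bE i j
  -- read in the chart of `x₀`: a `C^∞` function on `φ(U) × S ⊆ E × ℝ`
  set F : E × ℝ → ℝ := fun q ↦ f (ec.symm q.1, q.2) with hFdef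
  have hΦ : ContMDiffOn 𝓘(ℝ, E × ℝ) (I.prod 𝓘(ℝ, ℝ)) ∞ (fun q : E × ℝ ↦ (ec.symm q.1, q.2))
      (ec.target ×ˢ (univ : Set ℝ)) := by
    refine ContMDiffOn.prodMk ?_ ?_
    · exact (contMDiffOn_extChartAt_symm x₀).comp
        (contMDiff_iff_contDiff.2 contDiff_fst).contMDiffOn fun q hq ↦ hq.1
    · exact (contMDiff_iff_contDiff.2 contDiff_snd).contMDiffOn
  have hF : ContDiffOn ℝ ∞ F (ec.target ×ˢ S) := by
    rw [← contMDiffOn_iff_contDiffOn]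
    refine hf.comp (hΦ.mono (prod_mono le_rfl (subset_univ _))) fun q hq ↦ ⟨?_, hq.2⟩
    exact ec.map_target hq.1
  have hUD : UniqueDiffOn ℝ (ec.target ×ˢ S) := (isOpen_extChartAt_target x₀).uniqueDiffOn.prod hS
  have hDF : ContinuousOn (fun q ↦ fderivWithin ℝ F (ec.target ×ˢ S) q ((0 : E), (1 : ℝ)))
      (ec.target ×ˢ S) :=
    (hF.continuousOn_fderivWithin hUD (by simp)).clm_apply continuousOn_const
  -- the time derivative is `-2 Ric` (flow equation + uniqueness of one-sided derivatives)
  have hDF_eq : ∀ q ∈ ec.target ×ˢ S, fderivWithin ℝ F (ec.target ×ˢ S) q ((0 : E), (1 : ℝ)) =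
      -2 * (cov q.2).ricci (ec.symm q.1) (s i (ec.symm q.1)) (s j (ec.symm q.1)) := by
    rintro ⟨y, t⟩ hq
    have hderivF : HasFDerivWithinAt F (fderivWithin ℝ F (ec.target ×ˢ S) (y, t))
        (ec.target ×ˢ S) (y, t) :=
      (hF.differentiableOn (by simp) (y, t) hq).hasFDerivWithinAt
    have hcurve : HasDerivWithinAt (fun t' : ℝ ↦ ((y, t') : E × ℝ)) ((0 : E), (1 : ℝ)) S t :=
      (hasDerivWithinAt_const t S y).prodMk (hasDerivWithinAt_id t S)
    have hcomp : HasDerivWithinAt (fun t' : ℝ ↦ F (y, t'))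
        (fderivWithin ℝ F (ec.target ×ˢ S) (y, t) ((0 : E), (1 : ℝ))) S t :=
      hderivF.comp_hasDerivWithinAt t hcurve fun t' ht' ↦ ⟨hq.1, ht'⟩
    have hflow : HasDerivWithinAt (fun t' : ℝ ↦ F (y, t'))
        (-2 * (cov t).ricci (ec.symm y) (s i (ec.symm y)) (s j (ec.symm y))) S t := by
      simpa only [hFdef, hfdef] using
        h.hasDerivWithinAt t hq.2 (ec.symm y) (s i (ec.symm y)) (s j (ec.symm y))
    rw [← hcomp.derivWithin (hS t hq.2), hflow.derivWithin (hS t hq.2)]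
  -- hence the chart-read Ricci components are continuous on `φ(U) × S` …
  have hRicF : ContinuousOn (fun q : E × ℝ ↦
      (cov q.2).ricci (ec.symm q.1) (s i (ec.symm q.1)) (s j (ec.symm q.1))) (ec.target ×ˢ S) := by
    refine ((continuousOn_const (c := (-(1 / 2) : ℝ))).mul hDF).congr fun q hq ↦ ?_
    simp only [Pi.mul_apply]
    rw [hDF_eq q hq]
    ring
  -- … and so are the Ricci components on `U × S` (compose with the chart)
  have hchart : ContinuousOn (fun p : M × ℝ ↦ ((ec p.1, p.2) : E × ℝ)) (ec.source ×ˢ S) :=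
    ((continuousOn_extChartAt x₀).comp continuousOn_fst fun p hp ↦ hp.1).prodMk continuousOn_snd
  have hmaps : MapsTo (fun p : M × ℝ ↦ ((ec p.1, p.2) : E × ℝ)) (ec.source ×ˢ S) (ec.target ×ˢ S) :=
    fun p hp ↦ ⟨ec.map_source hp.1, hp.2⟩
  have hRic : ContinuousOn (fun p : M × ℝ ↦ (cov p.2).ricci p.1 (s i p.1) (s j p.1))
      (ec.source ×ˢ S) :=
    (hRicF.comp hchart hmaps).congr fun p hp ↦ by
      show _ = (cov p.2).ricci (ec.symm (ec p.1)) (s i (ec.symm (ec p.1))) (s j (ec.symm (ec p.1)))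
      rw [ec.left_inv hp.1]
  rwa [hec, extChartAt_source] at hRic

/-! ### Joint continuity of the scalar curvature -/

/-- **The scalar curvature of a Ricci flow is jointly continuous, locally**: on `U × S`, `U` the
chart domain of `x₀`, by `R = ∑ᵢⱼ (G⁻¹)ⱼᵢ Ric(sᵢ, sⱼ)` in the local frame of the trivialization
at `x₀` (`trace_eq_sum_gram_inv`; O'Neill 1983, pp. 60–61), the continuity of the Gram matrix
`G` (`contMDiffOn_val_localFrame`), of its inverse (`det G ≠ 0`, adjugate formula) and of the
Ricci components (`continuousOn_ricci_localFrame`). [cite: ONeill1983, Ch. 3, Def. 3.53 and pp. 60–61] -/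
theorem IsRicciFlow.continuousOn_scalarCurvatureWith_prod_source [I.Boundaryless]
    (h : IsRicciFlow g cov S) (hS : UniqueDiffOn ℝ S) (x₀ : M) :
    ContinuousOn (fun p : M × ℝ ↦ (g p.2).scalarCurvatureWith (cov p.2) p.1)
      ((chartAt H x₀).source ×ˢ S) := by
  classical
  set e := trivializationAt E (TangentSpace I : M → Type _) x₀ with he
  set bE := Module.finBasis ℝ E with hbE
  set G : M × ℝ → Matrix (Fin (Module.finrank ℝ E)) (Fin (Module.finrank ℝ E)) ℝ :=
    fun p ↦ Matrix.of fun i j ↦ (g p.2).val p.1 (e.localFrame bE i p.1) (e.localFrame bE j p.1)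
    with hGdef
  have hU : (chartAt H x₀).source = e.baseSet := (TangentBundle.trivializationAt_baseSet x₀).symm
  -- the formula in the frame
  have formula : ∀ p ∈ (chartAt H x₀).source ×ˢ S,
      (g p.2).scalarCurvatureWith (cov p.2) p.1 =
        ∑ i, ∑ j, (G p)⁻¹ j i *
          (cov p.2).ricci p.1 (e.localFrame bE i p.1) (e.localFrame bE j p.1) := by
    rintro ⟨x, t⟩ hp
    have hx : x ∈ e.baseSet := hU ▸ hp.1
    rw [scalarCurvatureWith, trace_eq_sum_gram_inv (g t) x (e.basisAt bE hx)]
    simp only [hGdef, e.localFrame_apply_of_mem_baseSet bE hx]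
  -- continuity of the Gram matrix, of its determinant, adjugate and inverse entries
  have hGij : ∀ i j, ContinuousOn (fun p ↦ G p i j) ((chartAt H x₀).source ×ˢ S) := by
    intro i j
    rw [hU]
    exact (h.smooth.contMDiffOn_val_localFrame e bE i j).continuousOn
  have hG : ContinuousOn G ((chartAt H x₀).source ×ˢ S) :=
    continuousOn_pi.2 fun i ↦ continuousOn_pi.2 fun j ↦ hGij i j
  have hdet : ContinuousOn (fun p ↦ (G p).det) ((chartAt H x₀).source ×ˢ S) :=
    (continuous_id.matrix_det).comp_continuousOn hG
  have hdet0 : ∀ p ∈ (chartAt H x₀).source ×ˢ S, (G p).det ≠ 0 := by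
    rintro ⟨x, t⟩ hp
    exact det_gram_localFrame_ne_zero e (g t) bE (hU ▸ hp.1)
  have hadjM : ContinuousOn (fun p ↦ (G p).adjugate) ((chartAt H x₀).source ×ˢ S) :=
    (continuous_id.matrix_adjugate).comp_continuousOn hG
  have hadj : ∀ i j, ContinuousOn (fun p ↦ (G p).adjugate i j) ((chartAt H x₀).source ×ˢ S) :=
    fun i j ↦ continuousOn_pi.1 (continuousOn_pi.1 hadjM i) j
  have hinv : ∀ i j, ContinuousOn (fun p ↦ (G p)⁻¹ i j) ((chartAt H x₀).source ×ˢ S) := by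
    intro i j
    simp only [Matrix.inv_def, Matrix.smul_apply, smul_eq_mul, Ring.inverse_eq_inv']
    exact (hdet.inv₀ hdet0).mul (hadj i j)
  -- assemble
  have hrhs : ContinuousOn (fun p : M × ℝ ↦ ∑ i, ∑ j, (G p)⁻¹ j i *
      (cov p.2).ricci p.1 (e.localFrame bE i p.1) (e.localFrame bE j p.1))
      ((chartAt H x₀).source ×ˢ S) := by
    refine continuousOn_finsetSum _ fun i _ ↦ continuousOn_finsetSum _ fun j _ ↦ ?_
    exact (hinv j i).mul (h.continuousOn_ricci_localFrame hS x₀ bE i j)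
  exact hrhs.congr formula

/-- **The scalar curvature of a Ricci flow is jointly continuous in space and time**: for a Ricci
flow `(g, cov)` on a time set `S ⊆ ℝ` with unique one-sided derivatives (`UniqueDiffOn ℝ S`, e.g.
`[0, ε]`, `[0, T)`, `[0, ∞)`) on a manifold without boundary, `(x, t) ↦ R(x, t)` is continuous on
`M × S` (Topping 2006, §1.2.3: under the standing convention "`g(t)` is a smooth family of smooth
metrics – smooth all the way to `t = 0` and `t = T`" all curvature quantities are continuous on
`M × [0, T]`; here from the flow equation, `continuousOn_scalarCurvatureWith_prod_source`).
[cite: Topping2006, §1.2.3] -/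
theorem IsRicciFlow.continuousOn_scalarCurvatureWith_prod [I.Boundaryless] (h : IsRicciFlow g cov S)
    (hS : UniqueDiffOn ℝ S) :
    ContinuousOn (fun p : M × ℝ ↦ (g p.2).scalarCurvatureWith (cov p.2) p.1) (univ ×ˢ S) := by
  rintro ⟨x₀, t₀⟩ hp
  have hloc := h.continuousOn_scalarCurvatureWith_prod_source hS x₀ (x₀, t₀)
    (mk_mem_prod (mem_chart_source H x₀) hp.2)
  refine hloc.mono_of_mem_nhdsWithin ?_
  have : (chartAt H x₀).source ×ˢ S = (univ ×ˢ S) ∩ ((chartAt H x₀).source ×ˢ (univ : Set ℝ)) := by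
    ext p; simp [and_comm]
  rw [this]
  exact inter_mem_nhdsWithin _
    (((chartAt H x₀).open_source.prod isOpen_univ).mem_nhds
      (mk_mem_prod (mem_chart_source H x₀) (mem_univ t₀)))

/-- **Bounded scalar curvature before the singular time** (Topping 2006, §7.3: for a Ricci flow on
a closed manifold on `[0, T)` one may pick "`(p_i, t_i)` to maximise `|Rm|` over
`M × [0, T - 1/i]`"; Chen–Zhu 2006, §5, p. 26): for a Ricci flow on a compact manifold without
boundary on a time set `S` with unique one-sided derivatives and every `[0, t₁] ⊆ S`, there is `K`
with `R(x, t) ≤ K` for all `x ∈ M`, `t ∈ [0, t₁]` (a continuous function is bounded above on the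
compact set `M × [0, t₁]`). [cite: Topping2006, §7.3] -/
theorem IsRicciFlow.exists_scalarCurvatureWith_le [I.Boundaryless] [CompactSpace M]
    (h : IsRicciFlow g cov S) (hS : UniqueDiffOn ℝ S) {t₁ : ℝ} (ht₁ : Icc 0 t₁ ⊆ S) :
    ∃ K : ℝ, ∀ t ∈ Icc 0 t₁, ∀ x : M, (g t).scalarCurvatureWith (cov t) x ≤ K := by
  have hcpt : IsCompact (univ ×ˢ Icc 0 t₁ : Set (M × ℝ)) := isCompact_univ.prod isCompact_Icc
  have hsub : (univ ×ˢ Icc 0 t₁ : Set (M × ℝ)) ⊆ univ ×ˢ S := prod_mono le_rfl ht₁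
  obtain ⟨K, hK⟩ :=
    (hcpt.image_of_continuousOn ((h.continuousOn_scalarCurvatureWith_prod hS).mono hsub)).bddAbove
  exact ⟨K, fun t ht x ↦ hK ⟨(x, t), ⟨mem_univ _, ht⟩, rfl⟩⟩

/-- The case of the layer: a Ricci flow on `[0, T)` on a compact manifold without boundary has
scalar curvature bounded above on `M × [0, t₁]` for every `t₁ < T`. [cite: Topping2006, §7.3] -/
theorem IsRicciFlow.exists_scalarCurvatureWith_le_of_lt [I.Boundaryless] [CompactSpace M] {T : ℝ}
    (h : IsRicciFlow g cov (Ico 0 T)) {t₁ : ℝ} (ht₁ : t₁ < T) :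
    ∃ K : ℝ, ∀ t ∈ Icc 0 t₁, ∀ x : M, (g t).scalarCurvatureWith (cov t) x ≤ K :=
  h.exists_scalarCurvatureWith_le (uniqueDiffOn_Ico 0 T) (Icc_subset_Ico_right ht₁)

end Literature.Geometry.Riemannian

end
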